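import Literature.ModelTheory.ExponentialFields.DefinablyCompleteMeanValue
import Literature.ModelTheory.ExponentialFields.DefinablyCompactUniformContinuity
import HarnessLib

/-!
# The definable implicit function theorem (one equation) over a definably complete ordered field

Topic `Literature/ModelTheory/ExponentialFields`.  Part of the first-order (`C¹`) calculus of
definable functions over a definably complete ordered field `K` — the setting of the models of
`OEF ∪ [DC]` — following Fornasiero–Servi, *Definably complete Baire structures*, Fund. Math.
209 (2010), §1.2 ("most results of elementary real analysis can be proved in every definably
complete expansion of an ordered field"): their §§3–8 (and Wilkie's model-completeness
arguments) solve `C¹` equations for one variable in terms of the others throughout.  This file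
proves the one-equation implicit function theorem for a definable `F : Kⁿ⁺¹ → K`, the unknown
being the last coordinate (`Fin.snoc x t`), in the monotone form that the definable intermediate
value theorem gives directly, split into its four classical parts:

* **existence and uniqueness on a fibre**
  (`IsDefinablyComplete.strictMonoOn_snoc`, `IsDefinablyComplete.existsUnique_snoc_eq_zero`):
  if `t ↦ F (x, t)` is continuous on `[c, d]` with positive last partial derivative on `(c, d)`
  then it is strictly increasing there (definable mean value theorem), and if moreover
  `F (x, c) < 0 < F (x, d)` it has exactly one zero, lying in `(c, d)` (definable intermediate
  value theorem);
* **a definable implicit function** (`IsDefinablyComplete.exists_definableFun_implicit`): if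
  this holds for every `x` in a definable set `U ⊆ Kⁿ`, there is a *definable* `φ : Kⁿ → K`
  with `φ x ∈ (c, d)` and `F (x, φ x) = 0` for `x ∈ U` (and `φ = c` off `U`); by uniqueness its
  graph over `U` is the zero set of `F` in `U × (c, d)`;
* **continuity** (`continuousAt_implicit`): any such selection `φ` is continuous at every
  interior point `x₀` of `U` at which the horizontal sections `x ↦ F (x, t)` (`t ∈ [c, d]`) are
  continuous — pure order topology, no definability needed;
* **differentiability** (`HasLinDerivAt.implicit`): if `F` is differentiable at `(x₀, φ x₀)`
  with gradient `g`, `g_last ≠ 0`, `φ` is continuous at `x₀` and `F (x, φ x) = 0` near `x₀`,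
  then `φ` is differentiable at `x₀` with gradient `(-gᵢ / g_last)ᵢ` — again pure `ε`–`δ`
  calculus for the norm-free differentiability predicate `HasLinDerivAt` of
  `DefinablyCompleteMeanValue.lean`.

Everything is proved; there are no definitions and no named facts.  Conventions: `hDC`
(definable completeness), `hlt`, `hadd`, `hmul` (graphs of `<`, `+`, `·` definable) and
`hF : DefinableFun F` as in the other definable-calculus files.

## References

* A. Fornasiero, T. Servi, *Definably complete Baire structures*, Fund. Math. 209 (2010),
  §1.2. [FornasieroServi2010]
* C. Miller, *Expansions of dense linear orders with the intermediate value property*,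
  J. Symbolic Logic 66 (2001) 1783–1790. [Miller2001]
* L. van den Dries, *Tame topology and o-minimal structures* (1998), Ch. 7, §2 (the implicit
  function theorem in o-minimal expansions of fields). [Dries1998]
-/

open Set Function FirstOrder FirstOrder.Language
open _root_.Filter _root_.Topology

namespace Literature.ModelTheory.ExponentialFields

universe u v

variable {K : Type*} [Field K] [LinearOrder K] [IsStrictOrderedRing K] [TopologicalSpace K]
  [OrderTopology K] {L : FirstOrder.Language.{u, v}} [L.Structure K] {n : ℕ}

/-! ### Tuples `Fin.snoc x t` -/

omit [LinearOrder K] [IsStrictOrderedRing K] [TopologicalSpace K] [OrderTopology K]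
  [L.Structure K] in
/-- `snoc x y + snoc h k = snoc (x + h) (y + k)`. [folklore] -/
theorem snoc_add_snoc (x h : Fin n → K) (y k : K) :
    (Fin.snoc x y : Fin (n + 1) → K) + (Fin.snoc h k : Fin (n + 1) → K) =
      (Fin.snoc (x + h) (y + k) : Fin (n + 1) → K) := by
  ext j
  induction j using Fin.lastCases with
  | last => simp
  | cast i => simp

omit [LinearOrder K] [IsStrictOrderedRing K] [TopologicalSpace K] [OrderTopology K]
  [L.Structure K] in
/-- `Σⱼ gⱼ (snoc h k)ⱼ = Σᵢ g_{castSucc i} hᵢ + g_last k`. [folklore] -/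
theorem sum_mul_snoc (g : Fin (n + 1) → K) (h : Fin n → K) (k : K) :
    ∑ j, g j * (Fin.snoc h k : Fin (n + 1) → K) j =
      ∑ i : Fin n, g (Fin.castSucc i) * h i + g (Fin.last n) * k := by
  rw [Fin.sum_univ_castSucc]
  simp

omit [IsStrictOrderedRing K] [TopologicalSpace K] [OrderTopology K] [L.Structure K] in
/-- `Σⱼ |(snoc h k)ⱼ| = Σᵢ |hᵢ| + |k|`. [folklore] -/
theorem sum_abs_snoc (h : Fin n → K) (k : K) :
    ∑ j, |(Fin.snoc h k : Fin (n + 1) → K) j| = ∑ i : Fin n, |h i| + |k| := by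
  rw [Fin.sum_univ_castSucc]
  simp

omit [LinearOrder K] [IsStrictOrderedRing K] [OrderTopology K] [L.Structure K] in
/-- The last partial derivative at `snoc x t` is the derivative of the fibre `s ↦ F (snoc x s)`
at `t`. [folklore] -/
theorem hasPartialDerivAt_last_snoc_iff {F : (Fin (n + 1) → K) → K} {d : K} {x : Fin n → K}
    {t : K} : HasPartialDerivAt F (Fin.last n) d (Fin.snoc x t) ↔
      HasFieldDerivAt (fun s => F (Fin.snoc x s)) d t := by
  rw [hasPartialDerivAt_iff]
  simp only [Fin.update_snoc_last, Fin.snoc_last]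

omit [LinearOrder K] [IsStrictOrderedRing K] [TopologicalSpace K] [OrderTopology K] in
/-- The fibre `s ↦ F (snoc x s)` of a definable `F` has a definable graph. [folklore] -/
theorem definable_graph_snoc {F : (Fin (n + 1) → K) → K} (hF : (univ : Set K).DefinableFun L F)
    (x : Fin n → K) :
    (univ : Set K).Definable L {v : Fin 2 → K | v 1 = F (Fin.snoc x (v 0))} := by
  have h := definable_graph_slice hF (Fin.snoc x (0 : K)) (Fin.last n)
  simpa only [Fin.update_snoc_last] using h

omit [Field K] [LinearOrder K] [IsStrictOrderedRing K] [TopologicalSpace K] [OrderTopology K] in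
/-- The map `v ↦ snoc (v ∘ some) (v none)` from `Option (Fin n)`-tuples to `Fin (n + 1)`-tuples
is definable (each coordinate is a projection). [folklore] -/
theorem definableMap_snoc_option :
    (univ : Set K).DefinableMap L
      (fun v : Option (Fin n) → K => (Fin.snoc (v ∘ some) (v none) : Fin (n + 1) → K)) := by
  intro j
  induction j using Fin.lastCases with
  | last =>
      simpa only [Fin.snoc_last] using
        definableFun_proj_params (L := L) (A := (univ : Set K)) (none : Option (Fin n))
  | cast i =>
      simpa only [Fin.snoc_castSucc, Function.comp_apply] using
        definableFun_proj_params (L := L) (A := (univ : Set K)) (some i : Option (Fin n))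

omit [Field K] [LinearOrder K] [IsStrictOrderedRing K] [TopologicalSpace K] [OrderTopology K] in
/-- `v ↦ F (snoc (v ∘ some) (v none))` is a definable function of `Option (Fin n)`-tuples.
[folklore] -/
theorem definableFun_snoc_option {F : (Fin (n + 1) → K) → K}
    (hF : (univ : Set K).DefinableFun L F) :
    (univ : Set K).DefinableFun L
      (fun v : Option (Fin n) → K => F (Fin.snoc (v ∘ some) (v none))) :=
  hF.comp definableMap_snoc_option

/-! ### One variable: exactly one solution under strict monotonicity -/

/-- **Intermediate value theorem with uniqueness**: a strictly increasing function with
definable graph, continuous on `[a, b]`, takes every value between `f a` and `f b` exactly once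
on `[a, b]` (definable intermediate value theorem of `DefinablyCompleteIntervals.lean` plus
injectivity). [folklore] -/
theorem _root_.FirstOrder.Language.IsDefinablyComplete.existsUnique_mem_Icc_eq
    (hDC : L.IsDefinablyComplete K)
    (hlt : (univ : Set K).Definable L {v : Fin 2 → K | v 0 < v 1})
    {f : K → K} (hf : (univ : Set K).Definable L {v : Fin 2 → K | v 1 = f (v 0)})
    {a b : K} (hab : a ≤ b) (hcont : ContinuousOn f (Icc a b)) (hmono : StrictMonoOn f (Icc a b))
    {y : K} (hay : f a ≤ y) (hyb : y ≤ f b) : ∃! c, c ∈ Icc a b ∧ f c = y := by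
  obtain ⟨c, hc, hfc⟩ := hDC.exists_mem_Icc_eq_of_continuousOn hlt hf hab hcont hay hyb
  exact ⟨c, ⟨hc, hfc⟩, fun c' hc' => hmono.injOn hc'.1 hc (hc'.2.trans hfc.symm)⟩

/-! ### Fibres: strict monotonicity, existence and uniqueness of the zero -/

/-- **A fibre with positive last partial derivative is strictly increasing**: if
`t ↦ F (snoc x t)` is continuous on `[c, d]` and `∂F/∂x_last > 0` at the points `snoc x t`,
`t ∈ (c, d)`, then the fibre is strictly increasing on `[c, d]` (definable mean value theorem,
`DefinablyCompleteCalculus.lean`). [folklore] -/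
theorem _root_.FirstOrder.Language.IsDefinablyComplete.strictMonoOn_snoc
    (hDC : L.IsDefinablyComplete K)
    (hlt : (univ : Set K).Definable L {v : Fin 2 → K | v 0 < v 1})
    (hadd : (univ : Set K).Definable L {v : Fin 3 → K | v 2 = v 0 + v 1})
    (hmul : (univ : Set K).Definable L {v : Fin 3 → K | v 2 = v 0 * v 1})
    {F : (Fin (n + 1) → K) → K} (hF : (univ : Set K).DefinableFun L F)
    {q : (Fin (n + 1) → K) → K} {x : Fin n → K} {c d : K}
    (hcont : ContinuousOn (fun t => F (Fin.snoc x t)) (Icc c d))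
    (hder : ∀ t ∈ Ioo c d, HasPartialDerivAt F (Fin.last n) (q (Fin.snoc x t)) (Fin.snoc x t))
    (hpos : ∀ t ∈ Ioo c d, 0 < q (Fin.snoc x t)) :
    StrictMonoOn (fun t => F (Fin.snoc x t)) (Icc c d) :=
  hDC.strictMonoOn_of_hasFieldDerivAt_pos hlt hadd hmul (definable_graph_snoc hF x)
    (f' := fun t => q (Fin.snoc x t)) hcont
    (fun t ht => hasPartialDerivAt_last_snoc_iff.1 (hder t ht)) hpos

/-- **Exactly one zero on a fibre**: if `t ↦ F (snoc x t)` is continuous and strictly increasing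
on `[c, d]` (`c ≤ d`) with `F (snoc x c) < 0 < F (snoc x d)`, then it has exactly one zero in
`(c, d)` (and none elsewhere in `[c, d]`). [folklore] -/
theorem _root_.FirstOrder.Language.IsDefinablyComplete.existsUnique_snoc_eq_zero
    (hDC : L.IsDefinablyComplete K)
    (hlt : (univ : Set K).Definable L {v : Fin 2 → K | v 0 < v 1})
    {F : (Fin (n + 1) → K) → K} (hF : (univ : Set K).DefinableFun L F)
    {x : Fin n → K} {c d : K} (hcd : c ≤ d)
    (hcont : ContinuousOn (fun t => F (Fin.snoc x t)) (Icc c d))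
    (hmono : StrictMonoOn (fun t => F (Fin.snoc x t)) (Icc c d))
    (hc : F (Fin.snoc x c) < 0) (hd : 0 < F (Fin.snoc x d)) :
    ∃! t, t ∈ Ioo c d ∧ F (Fin.snoc x t) = 0 := by
  obtain ⟨t, ⟨htI, hFt⟩, huniq⟩ :=
    hDC.existsUnique_mem_Icc_eq hlt (definable_graph_snoc hF x) hcd hcont hmono hc.le hd.le
  have htc : t ≠ c := fun h => hc.ne (by rw [← h, hFt])
  have htd : t ≠ d := fun h => hd.ne' (by rw [← h, hFt])
  refine ⟨t, ⟨⟨lt_of_le_of_ne htI.1 (Ne.symm htc), lt_of_le_of_ne htI.2 htd⟩, hFt⟩, ?_⟩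
  intro t' ht'
  exact huniq t' ⟨⟨ht'.1.1.le, ht'.1.2.le⟩, ht'.2⟩

/-! ### A definable implicit function -/

/-- **The definable implicit function** (existence): let `U ⊆ Kⁿ` be definable and suppose that
for every `x ∈ U` the fibre `t ↦ F (snoc x t)` is continuous and strictly increasing on `[c, d]`
with `F (snoc x c) < 0 < F (snoc x d)`.  Then there is a definable `φ : Kⁿ → K`, equal to `c` off
`U`, with `φ x ∈ (c, d)` and `F (snoc x (φ x)) = 0` for all `x ∈ U`.  (Its graph is
`{(x, y) | x ∈ U, c < y < d, F (x, y) = 0} ∪ {(x, c) | x ∉ U}`, definable by uniqueness of the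
zero.) [folklore] -/
theorem _root_.FirstOrder.Language.IsDefinablyComplete.exists_definableFun_implicit
    (hDC : L.IsDefinablyComplete K)
    (hlt : (univ : Set K).Definable L {v : Fin 2 → K | v 0 < v 1})
    {F : (Fin (n + 1) → K) → K} (hF : (univ : Set K).DefinableFun L F)
    {U : Set (Fin n → K)} (hU : (univ : Set K).Definable L U) {c d : K} (hcd : c ≤ d)
    (hcont : ∀ x ∈ U, ContinuousOn (fun t => F (Fin.snoc x t)) (Icc c d))
    (hmono : ∀ x ∈ U, StrictMonoOn (fun t => F (Fin.snoc x t)) (Icc c d))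
    (hc : ∀ x ∈ U, F (Fin.snoc x c) < 0) (hd : ∀ x ∈ U, 0 < F (Fin.snoc x d)) :
    ∃ φ : (Fin n → K) → K, (univ : Set K).DefinableFun L φ ∧ (∀ x ∉ U, φ x = c) ∧
      ∀ x ∈ U, φ x ∈ Ioo c d ∧ F (Fin.snoc x (φ x)) = 0 := by
  classical
  have hex : ∀ x ∈ U, ∃ t, t ∈ Ioo c d ∧ F (Fin.snoc x t) = 0 := fun x hx =>
    (hDC.existsUnique_snoc_eq_zero hlt hF hcd (hcont x hx) (hmono x hx) (hc x hx)
      (hd x hx)).exists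
  have huniq : ∀ x ∈ U, ∀ t t', (t ∈ Ioo c d ∧ F (Fin.snoc x t) = 0) →
      (t' ∈ Ioo c d ∧ F (Fin.snoc x t') = 0) → t = t' := fun x hx t t' ht ht' =>
    (hDC.existsUnique_snoc_eq_zero hlt hF hcd (hcont x hx) (hmono x hx) (hc x hx)
      (hd x hx)).unique ht ht'
  set φ : (Fin n → K) → K := fun x => if hx : x ∈ U then (hex x hx).choose else c with hφ
  have hφU : ∀ x ∈ U, φ x ∈ Ioo c d ∧ F (Fin.snoc x (φ x)) = 0 := by
    intro x hx
    have h := (hex x hx).choose_spec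
    simpa only [hφ, dif_pos hx] using h
  have hφU' : ∀ x ∉ U, φ x = c := fun x hx => by simp only [hφ, dif_neg hx]
  refine ⟨φ, ?_, hφU', hφU⟩
  -- definability of the graph
  have hUv : (univ : Set K).Definable L {v : Option (Fin n) → K | v ∘ some ∈ U} :=
    hU.preimage_comp some
  have hIoo : (univ : Set K).Definable L {v : Option (Fin n) → K | c < v none ∧ v none < d} :=
    definable_setOf_and_params
      (definable_setOf_lt_params hlt (definableFun_const_params _ (mem_univ c))
        (definableFun_proj_params none))
      (definable_setOf_lt_params hlt (definableFun_proj_params none)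
        (definableFun_const_params _ (mem_univ d)))
  have hF0 : (univ : Set K).Definable L
      {v : Option (Fin n) → K | F (Fin.snoc (v ∘ some) (v none)) = 0} := by
    have h := definable_setOf_eq_params (definableFun_snoc_option hF)
      (definableFun_const_params (Option (Fin n)) (mem_univ (0 : K)))
    exact h
  have hcst : (univ : Set K).Definable L {v : Option (Fin n) → K | v none = c} :=
    definable_setOf_eq_params (definableFun_proj_params none)
      (definableFun_const_params _ (mem_univ c))
  have hS : (univ : Set K).Definable L
      {v : Option (Fin n) → K | (v ∘ some ∈ U ∧ (c < v none ∧ v none < d) ∧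
        F (Fin.snoc (v ∘ some) (v none)) = 0) ∨ (¬ v ∘ some ∈ U ∧ v none = c)} :=
    definable_setOf_or_params
      (definable_setOf_and_params hUv (definable_setOf_and_params hIoo hF0))
      (definable_setOf_and_params (definable_setOf_not_params hUv) hcst)
  unfold Set.DefinableFun
  refine (congrArg _ ?_).mpr hS
  ext v
  simp only [Function.tupleGraph, mem_setOf_eq]
  by_cases hx : v ∘ some ∈ U
  · constructor
    · intro hv
      have h := hφU _ hx
      rw [hv] at h
      exact Or.inl ⟨hx, ⟨h.1.1, h.1.2⟩, h.2⟩
    · rintro (⟨-, hI, h0⟩ | ⟨hx', -⟩)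
      · exact huniq _ hx _ _ (hφU _ hx) ⟨⟨hI.1, hI.2⟩, h0⟩
      · exact absurd hx hx'
  · constructor
    · intro hv
      exact Or.inr ⟨hx, by rw [← hv, hφU' _ hx]⟩
    · rintro (⟨hx', -, -⟩ | ⟨-, hv⟩)
      · exact absurd hx' hx
      · rw [hv, hφU' _ hx]

omit [IsStrictOrderedRing K] [TopologicalSpace K] [OrderTopology K] in
/-- **The graph of an implicit selection over `U` is definable**: if the fibres over the
definable set `U` are strictly increasing on `[c, d]`, then for *any* selection `φ` of zeros in
`(c, d)` over `U` the set `{(x, φ x) | x ∈ U}` is definable (it is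
`{v | init v ∈ U, c < v_last < d, F v = 0}`). [folklore] -/
theorem definable_graph_implicit_of_strictMonoOn
    (hlt : (univ : Set K).Definable L {v : Fin 2 → K | v 0 < v 1})
    {F : (Fin (n + 1) → K) → K} (hF : (univ : Set K).DefinableFun L F)
    {U : Set (Fin n → K)} (hU : (univ : Set K).Definable L U) {c d : K}
    (hmono : ∀ x ∈ U, StrictMonoOn (fun t => F (Fin.snoc x t)) (Icc c d))
    {φ : (Fin n → K) → K} (hφ : ∀ x ∈ U, φ x ∈ Ioo c d ∧ F (Fin.snoc x (φ x)) = 0) :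
    (univ : Set K).Definable L
      {v : Fin (n + 1) → K | Fin.init v ∈ U ∧ v (Fin.last n) = φ (Fin.init v)} := by
  have hUv : (univ : Set K).Definable L {v : Fin (n + 1) → K | Fin.init v ∈ U} :=
    hU.preimage_comp Fin.castSucc
  have hIoo : (univ : Set K).Definable L
      {v : Fin (n + 1) → K | c < v (Fin.last n) ∧ v (Fin.last n) < d} :=
    definable_setOf_and_params
      (definable_setOf_lt_params hlt (definableFun_const_params _ (mem_univ c))
        (definableFun_proj_params (Fin.last n)))
      (definable_setOf_lt_params hlt (definableFun_proj_params (Fin.last n))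
        (definableFun_const_params _ (mem_univ d)))
  have hF0 : (univ : Set K).Definable L {v : Fin (n + 1) → K | F v = 0} := by
    have h := definable_setOf_eq_params hF
      (definableFun_const_params (Fin (n + 1)) (mem_univ (0 : K)))
    exact h
  have hS := definable_setOf_and_params hUv (definable_setOf_and_params hIoo hF0)
  refine (congrArg _ ?_).mpr hS
  ext v
  simp only [mem_setOf_eq]
  refine and_congr_right fun hx => ?_
  constructor
  · intro hv
    have h := hφ _ hx
    have hv' : v = Fin.snoc (Fin.init v) (φ (Fin.init v)) := by
      rw [← hv, Fin.snoc_init_self]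
    refine ⟨⟨?_, ?_⟩, ?_⟩
    · rw [hv]; exact h.1.1
    · rw [hv]; exact h.1.2
    · rw [hv']; exact h.2
  · rintro ⟨hI, h0⟩
    have h := hφ _ hx
    have hI' : v (Fin.last n) ∈ Icc c d := ⟨hI.1.le, hI.2.le⟩
    have hφI : φ (Fin.init v) ∈ Icc c d := ⟨h.1.1.le, h.1.2.le⟩
    refine (hmono _ hx).injOn hI' hφI ?_
    show F (Fin.snoc (Fin.init v) (v (Fin.last n))) = F (Fin.snoc (Fin.init v) (φ (Fin.init v)))
    rw [Fin.snoc_init_self, h0, h.2]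

/-! ### Continuity of the implicit function -/

omit [L.Structure K] in
/-- **Implicit selections are continuous**: let the fibres `t ↦ F (snoc x t)` be strictly
increasing on `[c, d]` for `x` in a neighbourhood `U` of `x₀`, let `φ` select a zero in
`(c, d)` over `U`, and let the sections `x ↦ F (snoc x t)`, `t ∈ [c, d]`, be continuous at `x₀`.
Then `φ` is continuous at `x₀`: for small `ε`, `F (x₀, φ x₀ - ε) < 0 < F (x₀, φ x₀ + ε)`
persists for `x` near `x₀` and pins `φ x` into `(φ x₀ - ε, φ x₀ + ε)`. [folklore] -/
theorem continuousAt_implicit {F : (Fin (n + 1) → K) → K}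
    {U : Set (Fin n → K)} {c d : K}
    {φ : (Fin n → K) → K} {x₀ : Fin n → K} (hU : U ∈ 𝓝 x₀)
    (hmono : ∀ x ∈ U, StrictMonoOn (fun t => F (Fin.snoc x t)) (Icc c d))
    (hφ : ∀ x ∈ U, φ x ∈ Ioo c d ∧ F (Fin.snoc x (φ x)) = 0)
    (hFc : ∀ t ∈ Icc c d, ContinuousAt (fun x => F (Fin.snoc x t)) x₀) :
    ContinuousAt φ x₀ := by
  rw [ContinuousAt, LinearOrderedAddCommGroup.tendsto_nhds]
  intro ε hε
  have hx₀ : x₀ ∈ U := mem_of_mem_nhds hU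
  obtain ⟨⟨hc0, hd0⟩, hF0⟩ := hφ x₀ hx₀
  -- a radius `ε'` with `φ x₀ ± ε' ∈ (c, d)` and `ε' < ε`
  set m : K := min ε (min (φ x₀ - c) (d - φ x₀)) with hm
  have hmpos : 0 < m := lt_min hε (lt_min (sub_pos.2 hc0) (sub_pos.2 hd0))
  set ε' : K := m / 2 with hε'
  have hε'pos : 0 < ε' := half_pos hmpos
  have hε'm : ε' < m := half_lt_self hmpos
  have hε'ε : ε' < ε := hε'm.trans_le (min_le_left _ _)
  have hlo : c < φ x₀ - ε' := by
    have : m ≤ φ x₀ - c := (min_le_right _ _).trans (min_le_left _ _)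
    linarith
  have hhi : φ x₀ + ε' < d := by
    have : m ≤ d - φ x₀ := (min_le_right _ _).trans (min_le_right _ _)
    linarith
  have hloI : φ x₀ - ε' ∈ Icc c d := ⟨hlo.le, by linarith⟩
  have hhiI : φ x₀ + ε' ∈ Icc c d := ⟨by linarith, hhi.le⟩
  have h0I : φ x₀ ∈ Icc c d := ⟨hc0.le, hd0.le⟩
  -- signs at `x₀`
  have h1 : F (Fin.snoc x₀ (φ x₀ - ε')) < 0 := by
    have h := hmono x₀ hx₀ hloI h0I (by linarith)
    simpa only [hF0] using h
  have h2 : 0 < F (Fin.snoc x₀ (φ x₀ + ε')) := by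
    have h := hmono x₀ hx₀ h0I hhiI (by linarith)
    simpa only [hF0] using h
  -- they persist near `x₀`
  have e1 : ∀ᶠ x in 𝓝 x₀, F (Fin.snoc x (φ x₀ - ε')) < 0 :=
    (hFc _ hloI).eventually (eventually_lt_nhds h1)
  have e2 : ∀ᶠ x in 𝓝 x₀, 0 < F (Fin.snoc x (φ x₀ + ε')) :=
    (hFc _ hhiI).eventually (eventually_gt_nhds h2)
  filter_upwards [hU, e1, e2] with x hxU hx1 hx2
  obtain ⟨⟨hcx, hdx⟩, hFx⟩ := hφ x hxU
  have hxI : φ x ∈ Icc c d := ⟨hcx.le, hdx.le⟩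
  rw [abs_sub_lt_iff]
  constructor
  · -- `φ x < φ x₀ + ε'`
    by_contra hge
    have hle : φ x₀ + ε' ≤ φ x := by linarith [not_lt.1 hge]
    have h := (hmono x hxU).monotoneOn hhiI hxI hle
    simp only [hFx] at h
    exact absurd hx2 (not_lt.2 h)
  · -- `φ x₀ - ε' < φ x`
    by_contra hge
    have hle : φ x ≤ φ x₀ - ε' := by linarith [not_lt.1 hge]
    have h := (hmono x hxU).monotoneOn hxI hloI hle
    simp only [hFx] at h
    exact absurd hx1 (not_lt.2 h)

/-! ### Differentiability of the implicit function -/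

omit [L.Structure K] in
/-- **Implicit selections are differentiable** where `F` is: if `F` is differentiable at
`(x₀, φ x₀)` with gradient `g`, `g_last ≠ 0`, `φ` is continuous at `x₀` and `F (x, φ x) = 0`
for `x` near `x₀`, then `φ` is differentiable at `x₀` with gradient `(-gᵢ / g_last)ᵢ`.
(From `0 = F (x₀ + h, φ x₀ + k) - F (x₀, φ x₀) = Σ gᵢ hᵢ + g_last k + o(Σ |hᵢ| + |k|)`,
`k = φ (x₀ + h) - φ x₀ → 0`, one first gets `|k| ≤ C Σ |hᵢ|`, then the claim.) [folklore] -/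
theorem HasLinDerivAt.implicit {F : (Fin (n + 1) → K) → K} {g : Fin (n + 1) → K}
    {φ : (Fin n → K) → K} {x₀ : Fin n → K}
    (hF : HasLinDerivAt F g (Fin.snoc x₀ (φ x₀))) (hg : g (Fin.last n) ≠ 0)
    (hφc : ContinuousAt φ x₀) (hφ0 : ∀ᶠ x in 𝓝 x₀, F (Fin.snoc x (φ x)) = 0) :
    HasLinDerivAt φ (fun i => -g (Fin.castSucc i) / g (Fin.last n)) x₀ := by
  intro ε hε
  -- constants
  set l : K := g (Fin.last n) with hl
  have hlpos : 0 < |l| := abs_pos.2 hg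
  have hl2 : 0 < |l| / 2 := half_pos hlpos
  set G : K := ∑ i : Fin n, |g (Fin.castSucc i)| with hG
  have hG0 : 0 ≤ G := Finset.sum_nonneg fun i _ => abs_nonneg _
  set C : K := (|l| / 2 + G) / (|l| / 2) with hC
  have hC0 : 0 ≤ C := div_nonneg (add_nonneg hl2.le hG0) hl2.le
  have hC1 : 0 < 1 + C := add_pos_of_pos_of_nonneg one_pos hC0
  set ε₁ : K := min (|l| / 2) (ε * |l| / (1 + C)) with hε₁
  have hε₁pos : 0 < ε₁ := lt_min hl2 (div_pos (mul_pos hε hlpos) hC1)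
  have hε₁l : ε₁ ≤ |l| / 2 := min_le_left _ _
  have hε₁e : ε₁ ≤ ε * |l| / (1 + C) := min_le_right _ _
  obtain ⟨δ₁, hδ₁, hFδ⟩ := hF ε₁ hε₁pos
  -- `k = φ (x₀ + h) - φ x₀` is small for small `h`
  obtain ⟨δ₂, hδ₂, hφδ⟩ : ∃ δ₂ : K, 0 < δ₂ ∧ ∀ h : Fin n → K, (∀ i, |h i| < δ₂) →
      |φ (x₀ + h) - φ x₀| < δ₁ := by
    have hev : ∀ᶠ x in 𝓝 x₀, |φ x - φ x₀| < δ₁ :=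
      (LinearOrderedAddCommGroup.tendsto_nhds.1 hφc) δ₁ hδ₁
    obtain ⟨ρ, hρ, hρt⟩ := exists_pos_forall_abs_sub_lt_subset_of_mem_nhds hev
    exact ⟨ρ, hρ, fun h hh => hρt (x₀ + h) fun i => by simpa using hh i⟩
  -- `F (x₀ + h, φ (x₀ + h)) = 0` for small `h`
  obtain ⟨δ₃, hδ₃, h0δ⟩ : ∃ δ₃ : K, 0 < δ₃ ∧ ∀ h : Fin n → K, (∀ i, |h i| < δ₃) →
      F (Fin.snoc (x₀ + h) (φ (x₀ + h))) = 0 := by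
    obtain ⟨ρ, hρ, hρt⟩ := exists_pos_forall_abs_sub_lt_subset_of_mem_nhds hφ0
    exact ⟨ρ, hρ, fun h hh => hρt (x₀ + h) fun i => by simpa using hh i⟩
  have hF00 : F (Fin.snoc x₀ (φ x₀)) = 0 := by
    have h := h0δ 0 fun i => by simpa using hδ₃
    simpa using h
  refine ⟨min δ₁ (min δ₂ δ₃), lt_min hδ₁ (lt_min hδ₂ hδ₃), fun h hh => ?_⟩
  have hh₁ : ∀ i, |h i| < δ₁ := fun i => (hh i).trans_le (min_le_left _ _)
  have hh₂ : ∀ i, |h i| < δ₂ := fun i =>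
    (hh i).trans_le ((min_le_right _ _).trans (min_le_left _ _))
  have hh₃ : ∀ i, |h i| < δ₃ := fun i =>
    (hh i).trans_le ((min_le_right _ _).trans (min_le_right _ _))
  -- differentiability of `F` applied to the increment `snoc h k`, `k = φ (x₀ + h) - φ x₀`
  have hkδ : |φ (x₀ + h) - φ x₀| < δ₁ := hφδ h hh₂
  have hH : ∀ j, |(Fin.snoc h (φ (x₀ + h) - φ x₀) : Fin (n + 1) → K) j| < δ₁ := by
    intro j
    induction j using Fin.lastCases with
    | last => simpa only [Fin.snoc_last] using hkδ
    | cast i => simpa only [Fin.snoc_castSucc] using hh₁ i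
  have hmain := hFδ (Fin.snoc h (φ (x₀ + h) - φ x₀)) hH
  rw [snoc_add_snoc, sum_mul_snoc, sum_abs_snoc, add_sub_cancel, h0δ h hh₃, hF00, ← hl]
    at hmain
  set k : K := φ (x₀ + h) - φ x₀ with hk
  set S : K := ∑ i : Fin n, |h i| with hS
  have hS0 : 0 ≤ S := Finset.sum_nonneg fun i _ => abs_nonneg _
  set A : K := ∑ i : Fin n, g (Fin.castSucc i) * h i with hA
  have hmain' : |A + l * k| ≤ ε₁ * (S + |k|) := by
    have h0 : (0 : K) - 0 - (A + l * k) = -(A + l * k) := by ring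
    rw [h0, abs_neg] at hmain
    exact hmain
  -- `|A| ≤ G S`
  have hAG : |A| ≤ G * S := by
    calc |A| ≤ ∑ i, |g (Fin.castSucc i) * h i| := Finset.abs_sum_le_sum_abs _ _
      _ = ∑ i, |g (Fin.castSucc i)| * |h i| := Finset.sum_congr rfl fun i _ => abs_mul _ _
      _ ≤ ∑ i, |g (Fin.castSucc i)| * S :=
          Finset.sum_le_sum fun i _ => mul_le_mul_of_nonneg_left
            (Finset.single_le_sum (f := fun j => |h j|) (fun j _ => abs_nonneg (h j))
              (Finset.mem_univ i)) (abs_nonneg _)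
      _ = G * S := by rw [hG, Finset.sum_mul]
  -- `|k| ≤ C S`
  have hlk : |l| * |k| ≤ |A + l * k| + |A| := by
    rw [← abs_mul]
    calc |l * k| = |(A + l * k) - A| := by ring_nf
      _ ≤ |A + l * k| + |A| := abs_sub _ _
  have hk1 : |l| * |k| ≤ ε₁ * S + ε₁ * |k| + G * S := by
    have h1 := hmain'
    rw [mul_add] at h1
    linarith
  have hk2 : |l| / 2 * |k| ≤ (|l| / 2 + G) * S := by
    have h1 : ε₁ * |k| ≤ |l| / 2 * |k| := mul_le_mul_of_nonneg_right hε₁l (abs_nonneg k)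
    have h2 : ε₁ * S ≤ |l| / 2 * S := mul_le_mul_of_nonneg_right hε₁l hS0
    have h3 : (|l| / 2 + G) * S = |l| / 2 * S + G * S := add_mul _ _ _
    have h4 : |l| * |k| = |l| / 2 * |k| + |l| / 2 * |k| := by ring
    linarith
  have hkC : |k| ≤ C * S := by
    rw [hC, div_mul_eq_mul_div, le_div_iff₀ hl2]
    calc |k| * (|l| / 2) = |l| / 2 * |k| := mul_comm _ _
      _ ≤ (|l| / 2 + G) * S := hk2
  -- conclusion
  have hsum : ∑ i, -g (Fin.castSucc i) / l * h i = -(A / l) := by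
    rw [hA, Finset.sum_div, ← Finset.sum_neg_distrib]
    exact Finset.sum_congr rfl fun i _ => by ring
  have hkey : k - ∑ i, -g (Fin.castSucc i) / l * h i = (A + l * k) / l := by
    rw [hsum, sub_neg_eq_add, add_div, mul_div_cancel_left₀ _ hg, add_comm]
  show |k - ∑ i, -g (Fin.castSucc i) / l * h i| ≤ ε * S
  rw [hkey, abs_div, div_le_iff₀ hlpos]
  calc |A + l * k| ≤ ε₁ * (S + |k|) := hmain'
    _ ≤ ε₁ * (S + C * S) :=
        mul_le_mul_of_nonneg_left ((add_le_add_iff_left S).2 hkC) hε₁pos.le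
    _ = ε₁ * (1 + C) * S := by ring
    _ ≤ ε * |l| / (1 + C) * (1 + C) * S :=
        mul_le_mul_of_nonneg_right (mul_le_mul_of_nonneg_right hε₁e hC1.le) hS0
    _ = ε * S * |l| := by
        rw [div_mul_cancel₀ _ hC1.ne']
        ring

end Literature.ModelTheory.ExponentialFields
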